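import Summits.QuantumFields.YangMills.Theorems.PoincareLipschitzSobolevSamplingL2RowLetters
import HarnessLib

/-!
# LINE 25 «CompactnessTransfer» (K2 crux `BlockLipschitzL` stmt-QuantumFields-23533 ∕ crux `HistoryTailL` stmt-QuantumFields-19936), S2♭″ brick (Γ5-D)
# «THE `L²` ROW»: the unit lattice sample `v` of a unit Sobolev map `V` (normalised cell averages on the good cells) is `L²(Q_s)`-close to `V`

Cell `ym3-torus` (YM ladder rung R3 = continuum SU(2) Yang–Mills on the three-torus — a RUNG, NOT the Clay problem: not `d = 4`, not infinite volume,
not a mass gap); width seat `ym-ust-19936-w4` gen 15, pen of record for (Γ5-D) (w7 g13 2026-08-29T13:00:37Z; LEAD w1 g10 S2♭″ architecture 12:29:32Z).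
THEOREMS ONLY (def-free); `--supports` the K2 crux as a helper.  STATEMENT = the knit's displayed hypothesis `hD` (px5 g8 (Γ5-KNIT) SIGNATURE-0, text
`KNIT-hD.text` 3d0da6a0) VERBATIM: for `V` with weak gradient `GV` on the open unit cube `Q`, `‖V‖ = 1` on `Q`, `Σᵢ‖GV·eᵢ‖²` integrable on `Q`, and
`0 < κ < 1`, `0 < s < 1`, `ε > 0`: for all large `R`, every family of cell averages `a y = R³∫_{cell_y}V` and every unit `v : ℤ³ → S³` with
`v y = a y∕‖a y‖` on the GOOD cells (`√(1−κ) ≤ ‖a y‖`) satisfies `∫_{Q_s} ‖v ⌊R x⌋ − V x‖² ≤ ε`.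

PROOF.  `‖v⌊Rx⌋ − V‖² ≤ 2‖v⌊Rx⌋ − a⌊Rx⌋‖² + 2‖a⌊Rx⌋ − V‖²`.  The second term is px15 g6's (a-iv) ✓`PoincareLipschitzSobolevCellTiling.exists_lintegral_sub_cellAverage_sq_le`
(`≤ C²R⁻²∫⁻_Q‖GV‖ₑ²`).  The first is a function of the floor label: `≤ R⁻³ Σ_{y ∈ box 0 (⌊sR⌋+1)} ‖v y − a y‖²` (§1 `setLIntegral_comp_floorVec_le_sum`, the
`ℝ≥0∞` twin of px3's letter); on a GOOD cell `‖v y − a y‖ = |1 − ‖a y‖| ≤ ‖a y − V x‖` for EVERY `x` of the cell (the distance to the sphere is at most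
the distance to any unit vector, `norm_normalize_sub_le`), so `R⁻³‖v y − a y‖² ≤ ∫_{cell_y}‖a y − V‖²`, and the disjoint good cells lie in
`Q_{(1+s)∕2}` — (a-iv) again (`sum_good_le`); on a BAD cell the summand is `≤ 4` and w7 g13's ✓`PoincareLipschitzSobolevBadCellCount.card_bad_mul_le`
counts them (`κ·#bad ≤ C²R·∫⁻_Q‖GV‖ₑ²`).  Total `O(R⁻²) ≤ ε` (`budget_le`).  All letters live in the companion file
`PoincareLipschitzSobolevSamplingL2RowLetters.lean` (also `setLIntegral_comp_floorVec_le_sum`, the `ℝ≥0∞` twin of px3's floor-cell letter, and the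
`dens`-letter ⇒ `MemLp (GV·w) 2` conversion `memLp_apply_of_integrableOn_dens`).
HONEST: one row of S2♭″'s (Γ5); (Γ5), S2♭″, S1″, the organ `hImproveCoreFlat`∕`hHalvingBand`, K1, `MeanDeviationL`, `BlockLipschitzL`, `HistoryTailL` are NOT
proved here.  [folklore] ([HardtKinderlehrerLin1986] §2 projection of cell averages; [AlicandroCicalese2008] §2; elementary measure theory).
-/

set_option autoImplicit false

noncomputable section

open MeasureTheory Set Filter Topology TopologicalSpace
open scoped NNReal ENNReal BigOperators

namespace Summit.QuantumFields.YangMills.Theorems.PoincareLipschitzSobolevSamplingL2Row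

open Literature.Analysis.FunctionSpaces (HasWeakFDerivOn)
open Literature.MathematicalPhysics.QuantumFieldTheory.Balaban1983to89
open B4Eq19LatticeOperators (Zd box mem_box)
open Summit.QuantumFields.YangMills.Theorems.PoincareLipschitzSamplingCells (isOpen_absCube measurableSet_cell disjoint_cell)
open Summit.QuantumFields.YangMills.Theorems.PoincareLipschitzSobolevCellAverages (norm_smul_setIntegral_cell_le_one volume_cell
  volume_real_cell)
open Summit.QuantumFields.YangMills.Theorems.PoincareLipschitzSobolevCellTiling (exists_lintegral_sub_cellAverage_sq_le cell_subset_unitCube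
  floor_eq_of_mem_hcell)
open Summit.QuantumFields.YangMills.Theorems.PoincareLipschitzSobolevBadCellCount (card_bad_mul_le opNorm_sq_le_dens
  integral_norm_sq_eq_toReal_lintegral)
open Summit.QuantumFields.YangMills.Theorems.PoincareLipschitzBlowDownCells (measurable_comp_floorVec measurableSet_floorCell
  volume_floorCell volume_floorCell_lt_top comp_floorVec_eq_sum_indicator)
open Summit.QuantumFields.YangMills.Theorems.PoincareLipschitzLatticeToContinuumSobolevLetters (aestronglyMeasurable_of_hasWeakFDerivOn
  integrableOn_normSq_sub_of_bound)
open Summit.QuantumFields.YangMills.Theorems.PoincareLipschitzSobolevSamplingL2RowLetters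

/-! ## §2 ★★★ (Γ5-D) THE `L²` ROW — the knit's `hD`, token for token -/

/-- ★★★ **(Γ5-D) THE `L²` ROW** (px5 g8's (Γ5-KNIT) hypothesis `hD`, VERBATIM).  For a unit map `V` on the open unit cube with weak gradient `GV` and integrable
density, `0 < κ < 1`, `0 < s < 1`, `ε > 0`: for `R ≥ R₀`, all cell-average families `a` and all unit `v` agreeing with `a∕‖a‖` on the good cells,
`∫_{Q_s}‖v ⌊R x⌋ − V x‖² ≤ ε`.  Route in the module docstring; constants: `R₀ := ⌈max (4∕(1−s)) (K∕ε)⌉₊ + 2`, `K := 4C_a²·I + 8C_b²·I∕κ`, `I := (∫⁻_Q‖GV‖ₑ²).toReal`.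
[folklore] [cite: HardtKinderlehrerLin1986, §2] -/
theorem l2_row_of_sobolev :
    ∀ (hQ : IsOpen {x : EuclideanSpace ℝ (Fin 3) | ∀ i : Fin 3, |x i| < 1})
      (V : EuclideanSpace ℝ (Fin 3) → EuclideanSpace ℝ (Fin 4)) (GV : EuclideanSpace ℝ (Fin 3) → (EuclideanSpace ℝ (Fin 3) →L[ℝ] EuclideanSpace ℝ (Fin 4))),
      HasWeakFDerivOn ⟨{x : EuclideanSpace ℝ (Fin 3) | ∀ i : Fin 3, |x i| < 1}, hQ⟩ volume V GV →
      (∀ x : EuclideanSpace ℝ (Fin 3), (∀ i : Fin 3, |x i| < 1) → ‖V x‖ = 1) →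
      IntegrableOn (fun x => ∑ i : Fin 3, ‖GV x (EuclideanSpace.single i (1:ℝ))‖ ^ 2) {x : EuclideanSpace ℝ (Fin 3) | ∀ i : Fin 3, |x i| < 1} volume →
      ∀ (κ s ε : ℝ), 0 < κ → κ < 1 → 0 < s → s < 1 → 0 < ε → ∃ R₀ : ℕ, ∀ R : ℕ, R₀ ≤ R →
      ∀ (a : Zd 3 → EuclideanSpace ℝ (Fin 4)),
        (∀ y, a y = ((R : ℝ) ^ 3) • ∫ x in {x : EuclideanSpace ℝ (Fin 3) | ∀ i, (y i : ℝ) / R < x i ∧ x i < ((y i : ℝ) + 1) / R}, V x) →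
        ∀ (v : Zd 3 → EuclideanSpace ℝ (Fin 4)), (∀ y, ‖v y‖ = 1) →
        (∀ y, Real.sqrt (1 - κ) ≤ ‖a y‖ → v y = ‖a y‖⁻¹ • a y) →
        ∫ x in {x : EuclideanSpace ℝ (Fin 3) | ∀ i : Fin 3, |x i| < s}, ‖v (fun i => ⌊(R : ℝ) * x i⌋) - V x‖ ^ 2 ≤ ε := by
  intro hQ V GV hV hV1 hdens κ s ε hκ hκ1 hs hs1 hε
  obtain ⟨CA, hCA⟩ := exists_lintegral_sub_cellAverage_sq_le
  obtain ⟨CB, hCB⟩ := card_bad_mul_le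
  -- the cube data in the rows' letters
  have hVm : AEStronglyMeasurable V (volume.restrict {x : EuclideanSpace ℝ (Fin 3) | ∀ i : Fin 3, |x i| < 1}) :=
    aestronglyMeasurable_of_hasWeakFDerivOn hV
  have hGV2 : ∀ w, MemLp (fun x => GV x w) 2 (volume.restrict {x : EuclideanSpace ℝ (Fin 3) | ∀ i : Fin 3, |x i| < 1}) :=
    fun w => memLp_apply_of_integrableOn_dens hV hdens w
  have hVle : ∀ᵐ x ∂(volume.restrict {x : EuclideanSpace ℝ (Fin 3) | ∀ i : Fin 3, |x i| < 1}), ‖V x‖ ≤ (1 : ℝ) :=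
    (ae_restrict_iff' (isOpen_absCube 1).measurableSet).mpr (ae_of_all _ fun x hx => (hV1 x hx).le)
  have hI'top : (∫⁻ x in {x : EuclideanSpace ℝ (Fin 3) | ∀ i : Fin 3, |x i| < 1}, ‖GV x‖ₑ ^ 2) ≠ ⊤ :=
    ne_top_of_le_ne_top ENNReal.ofReal_ne_top (lintegral_enorm_sq_le_ofReal_integral_dens hdens)
  obtain ⟨Ir, hIr0, hI'eq⟩ : ∃ Ir : ℝ, 0 ≤ Ir ∧
      (∫⁻ x in {x : EuclideanSpace ℝ (Fin 3) | ∀ i : Fin 3, |x i| < 1}, ‖GV x‖ₑ ^ 2) = ENNReal.ofReal Ir :=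
    ⟨_, ENNReal.toReal_nonneg, (ENNReal.ofReal_toReal hI'top).symm⟩
  -- `R₀`
  refine ⟨⌈max (4 / (1 - s)) ((4 * (CA : ℝ) ^ 2 * Ir + 8 * (CB : ℝ) ^ 2 * Ir / κ) / ε)⌉₊ + 2, ?_⟩
  intro R hR0R a ha v hv1 hvg
  -- facts about `R`
  have h1s : 0 < 1 - s := by linarith
  have hceil := Nat.le_ceil (max (4 / (1 - s)) ((4 * (CA : ℝ) ^ 2 * Ir + 8 * (CB : ℝ) ^ 2 * Ir / κ) / ε))
  have hc0 : (0 : ℝ) ≤ (⌈max (4 / (1 - s)) ((4 * (CA : ℝ) ^ 2 * Ir + 8 * (CB : ℝ) ^ 2 * Ir / κ) / ε)⌉₊ : ℕ) :=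
    Nat.cast_nonneg _
  have hRge : ((⌈max (4 / (1 - s)) ((4 * (CA : ℝ) ^ 2 * Ir + 8 * (CB : ℝ) ^ 2 * Ir / κ) / ε)⌉₊ : ℕ) : ℝ) + 2 ≤ R := by
    exact_mod_cast hR0R
  have hR4 : 4 / (1 - s) ≤ (R : ℝ) := by
    linarith [le_max_left (4 / (1 - s)) ((4 * (CA : ℝ) ^ 2 * Ir + 8 * (CB : ℝ) ^ 2 * Ir / κ) / ε)]
  have hRK : (4 * (CA : ℝ) ^ 2 * Ir + 8 * (CB : ℝ) ^ 2 * Ir / κ) / ε ≤ (R : ℝ) := by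
    linarith [le_max_right (4 / (1 - s)) ((4 * (CA : ℝ) ^ 2 * Ir + 8 * (CB : ℝ) ^ 2 * Ir / κ) / ε)]
  have hR2 : (2 : ℝ) ≤ R := by linarith
  have hR0 : (0 : ℝ) < R := by linarith
  have hRpos : 0 < R := by exact_mod_cast hR0
  have hsR4 : 4 ≤ (1 - s) * R := by rw [div_le_iff₀ h1s] at hR4; linarith
  have hfloor_s : ⌊s * (R : ℝ)⌋ + 2 ≤ (R : ℤ) := by
    have h := Int.floor_le (s * (R : ℝ))
    have h' : ((⌊s * (R : ℝ)⌋ : ℤ) : ℝ) + 2 ≤ R := by linarith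
    exact_mod_cast h'
  have hfloor_s'' : ⌊(1 + s) / 2 * (R : ℝ)⌋ + 2 ≤ (R : ℤ) := by
    have h := Int.floor_le ((1 + s) / 2 * (R : ℝ))
    have h' : ((⌊(1 + s) / 2 * (R : ℝ)⌋ : ℤ) : ℝ) + 2 ≤ R := by linarith
    exact_mod_cast h'
  have hN1 : ⌊s * (R : ℝ)⌋ + 1 + 1 ≤ (R : ℤ) := by linarith
  have hcellQ : ∀ y ∈ box (0 : Zd 3) (⌊s * (R : ℝ)⌋ + 1),
      {x : EuclideanSpace ℝ (Fin 3) | ∀ i, (y i : ℝ) / R < x i ∧ x i < ((y i : ℝ) + 1) / R} ⊆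
        {x : EuclideanSpace ℝ (Fin 3) | ∀ i : Fin 3, |x i| < 1} :=
    fun y hy => cell_subset_unitCube hRpos hN1 hy
  -- `‖a y‖ ≤ 1` on those cells
  have ha1 : ∀ y ∈ box (0 : Zd 3) (⌊s * (R : ℝ)⌋ + 1), ‖a y‖ ≤ 1 := by
    intro y hy
    rw [ha y]
    exact norm_smul_setIntegral_cell_le_one hRpos y V
      ((ae_restrict_iff' (measurableSet_cell R y)).mpr (ae_of_all _ fun x hx => (hV1 x (hcellQ y hy hx)).le))
  -- (a-iv) at `s` and at `(1+s)/2`, the bad count (all in `ℝ≥0∞`), then their real forms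
  have hA := hCA R hRpos s hfloor_s V GV 1 hV hVle hGV2 a ha
  have hA'' := hCA R hRpos ((1 + s) / 2) hfloor_s'' V GV 1 hV hVle hGV2 a ha
  have hBad := hCB R hRpos V GV hV hV1 hGV2 (box (0 : Zd 3) (⌊s * (R : ℝ)⌋ + 1)) hcellQ a ha κ hκ
  have hRi2 : 0 ≤ ((R : ℝ)⁻¹) ^ 2 := by positivity
  have eRHS : (CA : ℝ≥0∞) ^ 2 * ENNReal.ofReal (((R : ℝ)⁻¹) ^ 2) *
      (∫⁻ x in {x : EuclideanSpace ℝ (Fin 3) | ∀ i : Fin 3, |x i| < 1}, ‖GV x‖ₑ ^ 2) =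
      ENNReal.ofReal ((CA : ℝ) ^ 2 * ((R : ℝ)⁻¹) ^ 2 * Ir) := by
    rw [hI'eq]; exact coe_sq_mul_ofReal_mul CA Ir hRi2
  rw [eRHS] at hA hA''
  set nb : ℝ := (((box (0 : Zd 3) (⌊s * (R : ℝ)⌋ + 1)).filter (fun y => ‖a y‖ ^ 2 < 1 - κ)).card : ℝ) with hnb
  have hnb0 : 0 ≤ nb := Nat.cast_nonneg _
  have hbadR : κ * nb ≤ (CB : ℝ) ^ 2 * R * Ir := by
    have h := hBad
    have e1 : ENNReal.ofReal κ * ((((box (0 : Zd 3) (⌊s * (R : ℝ)⌋ + 1)).filter (fun y => ‖a y‖ ^ 2 < 1 - κ)).card : ℕ) : ℝ≥0∞) =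
        ENNReal.ofReal (κ * nb) := by
      rw [hnb, ENNReal.ofReal_mul hκ.le, ENNReal.ofReal_natCast]
    rw [e1, hI'eq, coe_sq_mul_ofReal_mul CB Ir hR0.le] at h
    exact (ENNReal.ofReal_le_ofReal_iff (by positivity)).1 h
  -- the good cells (§1 `sum_good_le` over (a-iv) at `(1+s)/2`)
  have hsumgood : ∑ y ∈ (box (0 : Zd 3) (⌊s * (R : ℝ)⌋ + 1)).filter (fun y => Real.sqrt (1 - κ) ≤ ‖a y‖),
      ((R : ℝ)⁻¹) ^ 3 * ‖v y - a y‖ ^ 2 ≤ (CA : ℝ) ^ 2 * ((R : ℝ)⁻¹) ^ 2 * Ir :=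
    sum_good_le hRpos hsR4 hN1 hκ1 hV1 hVm ha1 hvg (by positivity) hA''
  -- T1: the floor-label term, in `ℝ≥0∞`
  have hflY : ∀ x ∈ {x : EuclideanSpace ℝ (Fin 3) | ∀ i : Fin 3, |x i| < s},
      (fun i => ⌊(R : ℝ) * x i⌋ : Zd 3) ∈ box (0 : Zd 3) (⌊s * (R : ℝ)⌋ + 1) := fun x hx => floorVec_mem_box hx
  have hT1 : ∫⁻ x in {x : EuclideanSpace ℝ (Fin 3) | ∀ i : Fin 3, |x i| < s},
      ‖v (fun i => ⌊(R : ℝ) * x i⌋) - a (fun i => ⌊(R : ℝ) * x i⌋)‖ₑ ^ 2 ≤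
      ENNReal.ofReal (((R : ℝ)⁻¹) ^ 3 * ∑ y ∈ box (0 : Zd 3) (⌊s * (R : ℝ)⌋ + 1), ‖v y - a y‖ ^ 2) := by
    have h := setLIntegral_comp_floorVec_le_sum hR0 (isOpen_absCube s).measurableSet _ hflY (fun y => ‖v y - a y‖ₑ ^ 2)
    refine h.trans (le_of_eq ?_)
    have hR3 : 0 ≤ ((R : ℝ)⁻¹) ^ 3 := by positivity
    have hRi : 0 ≤ (R : ℝ)⁻¹ := by positivity
    rw [ENNReal.ofReal_mul hR3, ENNReal.ofReal_pow hRi,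
      ENNReal.ofReal_sum_of_nonneg (fun y _ => by positivity)]
    congr 1
    exact Finset.sum_congr rfl fun y _ => by rw [← ofReal_norm, ENNReal.ofReal_pow (norm_nonneg _)]
  -- the real bound for the floor-label sum
  have hT1r : ((R : ℝ)⁻¹) ^ 3 * ∑ y ∈ box (0 : Zd 3) (⌊s * (R : ℝ)⌋ + 1), ‖v y - a y‖ ^ 2 ≤
      (CA : ℝ) ^ 2 * ((R : ℝ)⁻¹) ^ 2 * Ir + 4 * ((R : ℝ)⁻¹) ^ 3 * nb := by
    rw [← Finset.sum_filter_add_sum_filter_not (box (0 : Zd 3) (⌊s * (R : ℝ)⌋ + 1))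
      (fun y => Real.sqrt (1 - κ) ≤ ‖a y‖) (fun y => ‖v y - a y‖ ^ 2), mul_add, Finset.mul_sum]
    have hfc : (box (0 : Zd 3) (⌊s * (R : ℝ)⌋ + 1)).filter (fun y => ¬ (Real.sqrt (1 - κ) ≤ ‖a y‖)) =
        (box (0 : Zd 3) (⌊s * (R : ℝ)⌋ + 1)).filter (fun y => ‖a y‖ ^ 2 < 1 - κ) := by
      refine Finset.filter_congr fun y _ => ?_
      rw [not_le, Real.lt_sqrt (norm_nonneg _)]
    have hbad : ((R : ℝ)⁻¹) ^ 3 * ∑ y ∈ (box (0 : Zd 3) (⌊s * (R : ℝ)⌋ + 1)).filter (fun y => ¬ (Real.sqrt (1 - κ) ≤ ‖a y‖)),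
        ‖v y - a y‖ ^ 2 ≤ 4 * ((R : ℝ)⁻¹) ^ 3 * nb := by
      rw [hfc]
      have hterm : ∀ y ∈ (box (0 : Zd 3) (⌊s * (R : ℝ)⌋ + 1)).filter (fun y => ‖a y‖ ^ 2 < 1 - κ), ‖v y - a y‖ ^ 2 ≤ 4 := by
        intro y hy
        have hyY := (Finset.mem_filter.1 hy).1
        have h := norm_sub_le (v y) (a y)
        rw [hv1] at h
        have := ha1 y hyY
        nlinarith [norm_nonneg (v y - a y)]
      have hs4 := Finset.sum_le_sum hterm
      rw [Finset.sum_const, nsmul_eq_mul] at hs4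
      have hR3 : 0 ≤ ((R : ℝ)⁻¹) ^ 3 := by positivity
      have := mul_le_mul_of_nonneg_left hs4 hR3
      rw [hnb]
      linarith
    linarith
  -- measurability for the split
  have hfv : Measurable fun x : EuclideanSpace ℝ (Fin 3) => v (fun i => ⌊(R : ℝ) * x i⌋) := measurable_comp_floorVec v (R : ℝ)
  have hfa : Measurable fun x : EuclideanSpace ℝ (Fin 3) => a (fun i => ⌊(R : ℝ) * x i⌋) := measurable_comp_floorVec a (R : ℝ)
  have hmeasA : Measurable fun x : EuclideanSpace ℝ (Fin 3) =>
      2 * ‖v (fun i => ⌊(R : ℝ) * x i⌋) - a (fun i => ⌊(R : ℝ) * x i⌋)‖ₑ ^ 2 :=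
    ((hfv.sub hfa).enorm.pow_const 2).const_mul 2
  -- assemble in `ℝ≥0∞`
  have hQsQ : {x : EuclideanSpace ℝ (Fin 3) | ∀ i : Fin 3, |x i| < s} ⊆ {x : EuclideanSpace ℝ (Fin 3) | ∀ i : Fin 3, |x i| < 1} :=
    fun x hx i => (hx i).trans hs1
  have hY0' : (0 : ℝ) ≤ (CA : ℝ) ^ 2 * ((R : ℝ)⁻¹) ^ 2 * Ir := by positivity
  have hR3' : (0 : ℝ) ≤ 4 * ((R : ℝ)⁻¹) ^ 3 := by positivity
  have hX0 : (0 : ℝ) ≤ 2 * ((CA : ℝ) ^ 2 * ((R : ℝ)⁻¹) ^ 2 * Ir + 4 * ((R : ℝ)⁻¹) ^ 3 * nb) :=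
    mul_nonneg zero_le_two (add_nonneg hY0' (mul_nonneg hR3' hnb0))
  have hY0 : (0 : ℝ) ≤ 2 * ((CA : ℝ) ^ 2 * ((R : ℝ)⁻¹) ^ 2 * Ir) := mul_nonneg zero_le_two hY0'
  have hlin : ∫⁻ x in {x : EuclideanSpace ℝ (Fin 3) | ∀ i : Fin 3, |x i| < s}, ‖v (fun i => ⌊(R : ℝ) * x i⌋) - V x‖ₑ ^ 2 ≤
      ENNReal.ofReal (2 * ((CA : ℝ) ^ 2 * ((R : ℝ)⁻¹) ^ 2 * Ir + 4 * ((R : ℝ)⁻¹) ^ 3 * nb) +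
        2 * ((CA : ℝ) ^ 2 * ((R : ℝ)⁻¹) ^ 2 * Ir)) := by
    calc ∫⁻ x in {x : EuclideanSpace ℝ (Fin 3) | ∀ i : Fin 3, |x i| < s}, ‖v (fun i => ⌊(R : ℝ) * x i⌋) - V x‖ₑ ^ 2
        ≤ ∫⁻ x in {x : EuclideanSpace ℝ (Fin 3) | ∀ i : Fin 3, |x i| < s},
            (2 * ‖v (fun i => ⌊(R : ℝ) * x i⌋) - a (fun i => ⌊(R : ℝ) * x i⌋)‖ₑ ^ 2 +
              2 * ‖a (fun i => ⌊(R : ℝ) * x i⌋) - V x‖ₑ ^ 2) :=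
          lintegral_mono fun x => enorm_sub_sq_le_two _ _ _
      _ = 2 * (∫⁻ x in {x : EuclideanSpace ℝ (Fin 3) | ∀ i : Fin 3, |x i| < s},
              ‖v (fun i => ⌊(R : ℝ) * x i⌋) - a (fun i => ⌊(R : ℝ) * x i⌋)‖ₑ ^ 2) +
          2 * (∫⁻ x in {x : EuclideanSpace ℝ (Fin 3) | ∀ i : Fin 3, |x i| < s},
              ‖a (fun i => ⌊(R : ℝ) * x i⌋) - V x‖ₑ ^ 2) := by
          rw [lintegral_add_left hmeasA, lintegral_const_mul' _ _ ENNReal.ofNat_ne_top,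
            lintegral_const_mul' _ _ ENNReal.ofNat_ne_top]
      _ ≤ 2 * ENNReal.ofReal (((R : ℝ)⁻¹) ^ 3 * ∑ y ∈ box (0 : Zd 3) (⌊s * (R : ℝ)⌋ + 1), ‖v y - a y‖ ^ 2) +
          2 * ENNReal.ofReal ((CA : ℝ) ^ 2 * ((R : ℝ)⁻¹) ^ 2 * Ir) :=
          add_le_add (mul_le_mul_of_nonneg_left hT1 bot_le) (mul_le_mul_of_nonneg_left hA bot_le)
      _ ≤ 2 * ENNReal.ofReal ((CA : ℝ) ^ 2 * ((R : ℝ)⁻¹) ^ 2 * Ir + 4 * ((R : ℝ)⁻¹) ^ 3 * nb) +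
          2 * ENNReal.ofReal ((CA : ℝ) ^ 2 * ((R : ℝ)⁻¹) ^ 2 * Ir) :=
          add_le_add (mul_le_mul_of_nonneg_left (ENNReal.ofReal_le_ofReal hT1r) bot_le) le_rfl
      _ = _ := by
          have h2 : (0 : ℝ) ≤ 2 := by norm_num
          rw [ENNReal.ofReal_add hX0 hY0, ENNReal.ofReal_mul h2, ENNReal.ofReal_mul h2, ENNReal.ofReal_ofNat]
  -- the real budget `≤ ε`
  have hbudget : 2 * ((CA : ℝ) ^ 2 * ((R : ℝ)⁻¹) ^ 2 * Ir + 4 * ((R : ℝ)⁻¹) ^ 3 * nb) +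
      2 * ((CA : ℝ) ^ 2 * ((R : ℝ)⁻¹) ^ 2 * Ir) ≤ ε :=
    budget_le hκ hε hIr0 (by linarith) hbadR hRK
  -- back to the Bochner integral
  have hmeasF : AEStronglyMeasurable (fun x : EuclideanSpace ℝ (Fin 3) => v (fun i => ⌊(R : ℝ) * x i⌋) - V x)
      (volume.restrict {x : EuclideanSpace ℝ (Fin 3) | ∀ i : Fin 3, |x i| < s}) :=
    hfv.aestronglyMeasurable.sub (hVm.mono_measure (Measure.restrict_mono hQsQ le_rfl))
  rw [show (∫ x in {x : EuclideanSpace ℝ (Fin 3) | ∀ i : Fin 3, |x i| < s}, ‖v (fun i => ⌊(R : ℝ) * x i⌋) - V x‖ ^ 2) =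
      (∫⁻ x in {x : EuclideanSpace ℝ (Fin 3) | ∀ i : Fin 3, |x i| < s}, ‖v (fun i => ⌊(R : ℝ) * x i⌋) - V x‖ₑ ^ 2).toReal
    from integral_norm_sq_eq_toReal_lintegral _ hmeasF]
  calc (∫⁻ x in {x : EuclideanSpace ℝ (Fin 3) | ∀ i : Fin 3, |x i| < s}, ‖v (fun i => ⌊(R : ℝ) * x i⌋) - V x‖ₑ ^ 2).toReal
      ≤ (ENNReal.ofReal (2 * ((CA : ℝ) ^ 2 * ((R : ℝ)⁻¹) ^ 2 * Ir + 4 * ((R : ℝ)⁻¹) ^ 3 * nb) +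
        2 * ((CA : ℝ) ^ 2 * ((R : ℝ)⁻¹) ^ 2 * Ir))).toReal := ENNReal.toReal_mono ENNReal.ofReal_ne_top hlin
    _ = _ := ENNReal.toReal_ofReal (add_nonneg hX0 hY0)
    _ ≤ ε := hbudget

end Summit.QuantumFields.YangMills.Theorems.PoincareLipschitzSobolevSamplingL2Row

end
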